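import Literature.NumberTheory.Automorphic.PairLFunctionMeromorphicContinuationRankNeProofs
import Literature.NumberTheory.Automorphic.RankinSelbergIntegralNeConjResidue
import HarnessLib

/-!
# Mœglin–Waldspurger, Corollaire (i)(b) (`π ≇ σ̃`: `L^S(s, π ⊗ σ)` entire): the one-family form,
the symmetry `π ↔ σ`, and the entire-quotient / vanishing-residue forms at the ramified set

Topic `NumberTheory/Automorphic`; namespace `Literature.NumberTheory.Automorphic`. Proof file
(theorems only: no definition, no named fact, no instance), sibling of
`PairLFunctionMeromorphicContinuation`, under its named fact
`MoeglinWaldspurger1989_partialPairL_entire_of_ne_conj` — C. Mœglin, J.-L. Waldspurger, *Le spectre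
résiduel de `GL(n)`*, Ann. Sci. ÉNS (4) 22 (1989), Appendice, Corollaire (i)(b), p. 667 (PDF p. 64
of the held copy doi:10.24033/asens.1595): for unitary cuspidal `ρ`, `ρ'` on `GL(n, 𝔸)` with
`ρ ≇ ρ̌'[t]` for all `t`, "`L(s, ρ × ρ')` est entière"; J. W. Cogdell, *Analytic theory of
`L`-functions for `GL_n`*, Thm. 4.2 (`m = n`, `π ≇ π̃' ⊗ |det|^{iσ}`). The tree's fact asks for an
entire continuation of the partial Euler product `L^S(s, π ⊗ σ) = partialPairL S α β s` for **every**
finite `S` and **all** honest Satake families `α`, `β` off `S`, for `P ≠ P'.conj` under multiplicity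
one. This file is the equal-rank companion of `PairLFunctionMeromorphicContinuationRankNeProofs`
(Corollaire (i)(a)), whose bookkeeping it reuses verbatim (`exists_entire_eq_partialPairL_of_ramified_datum`,
all ranks: an entire continuation off the exact joint ramified set `S₀` transfers to every admissible
`S ⊇ S₀`, the moved inverse Euler factors being entire, and `α = α₀`, `β = β₀` off `S` by the
uniqueness of Hecke–Satake parameters):

* `MoeglinWaldspurger1989_partialPairL_entire_of_ne_conj_of_one_family` / `…_iff_one_family` —
  the named fact is **equivalent to one datum per pair** `(π, σ)`, `π ≠ σ̄`, `n ≥ 1` (multiplicity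
  one): Satake families `α₀`, `β₀` off a set `S₀` of places each ramified for `π` or for `σ`, and an
  entire continuation of `L^{S₀}(s, α₀ ⊗ β₀)` — what the Corollaire prints for the canonical classes,
  divided by the finitely many ramified and archimedean local factors (reciprocals entire);
* `MoeglinWaldspurger1989_partialPairL_entire_of_ne_conj_of_swap` — the hypothesis is symmetric:
  the fact for the pairs `(σ, π)` gives it for the pairs `(π, σ)` (`L^S(α ⊗ β) = L^S(β ⊗ α)`,
  `partialPairL_comm`; `π ≠ σ̄ ↔ σ ≠ π̄`, `CuspidalAutomorphicRepGL.conj_eq_iff_eq_conj`);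
* `MoeglinWaldspurger1989_partialPairL_entire_of_ne_conj_of_entire_quotients_ramified` — the fact
  from entire quotient representations `J = A · L^{S₀}(α₀ ⊗ β₀)` (`Re s > x₀`, `A(s₀) ≠ 0` at any
  prescribed `s₀`) **at the ramified set only** (Cogdell (2004), §4.2: `J = I(s; φ, φ', Φ) /
  ∏_{v ∈ S₀ ∪ S_∞} L(s, π_v × σ_v)`, entire because the global integrals are entire for `π ≇ σ̃`;
  `A = ∏_v e_v`), combining `exists_entire_eq_partialPairL_of_entire_quotients_of_isSatakeFamilyOf`
  with the one-family form;
* `MoeglinWaldspurger1989_partialPairL_entire_of_ne_conj_of_entire_mul_ramified` — the fact from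
  the Corollaire-(ii)-shaped datum at the ramified set: an entire `G` with `G 0 = G 1 = 0` and
  `G = s (s - 1) L^{S₀}(α₀ ⊗ β₀)` on `Re s > 1` (the removable-pole glue
  `exists_entire_eq_of_entire_mul_of_apply_eq_zero` of `RankinSelbergIntegralNeConjResidue`, where the
  vanishing of the residue at `s = 1` for `π ≠ σ̄` is proved).

What is NOT here: the analytic content (entire continuation of `s (s - 1) I(s; φ, φ', Φ)`, Euler
factorisation at complex `s`, local non-vanishing at `S₀ ∪ S_∞`), recorded in the census of the fact.

## References

* C. Mœglin, J.-L. Waldspurger, *Le spectre résiduel de `GL(n)`*, Ann. Sci. École Norm. Sup. (4)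
  22 (1989), 605–674: Appendice, Corollaire (i)(b), p. 667. [MoeglinWaldspurger1989]
* J. W. Cogdell, *Analytic theory of `L`-functions for `GL_n`*, in: An Introduction to the
  Langlands Program (Birkhäuser, 2004), §4.1–§4.2, Thm. 4.2. [CogdellAnalyticTheory2004]
-/

noncomputable section

open scoped MatrixGroups Topology
open NumberField IsDedekindDomain MeasureTheory Filter Complex Set

namespace Literature.NumberTheory.Automorphic

open AdelicGroupData

section OneFamily

variable {n : ℕ} {K : Type} [Field K] [NumberField K]
  {μ : Measure (gl n K).automorphicQuotient} [(gl n K).IsAutomorphicMeasure μ]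

/-- **Mœglin–Waldspurger, Corollaire (i)(b), from its one-family form.** The named fact
`MoeglinWaldspurger1989_partialPairL_entire_of_ne_conj` — for **all** finite `S` and **all** Satake
families off `S` — follows from **one datum per pair** `(π, σ)` with `π ≠ σ̄` (`n ≥ 1`, multiplicity
one on `L²_cusp(GL_n)`): Satake families `α₀`, `β₀` of `π`, `σ` off a set `S₀` of places each
ramified for `π` or for `σ`, and an entire continuation of `L^{S₀}(s, α₀ ⊗ β₀)`
(`exists_entire_eq_partialPairL_of_ramified_datum` at `m = n`). [cite: MoeglinWaldspurger1989, Appendice, Corollaire (i)(b), p. 667]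
[cite: CogdellAnalyticTheory2004, Thm. 4.2 and §4.2] -/
theorem MoeglinWaldspurger1989_partialPairL_entire_of_ne_conj_of_one_family
    (h : ∀ (_hn : 0 < n) (_h₁ : multiplicity_one_gl n K μ) (P P' : CuspidalAutomorphicRepGL n K μ)
      (_hne : P ≠ P'.conj),
      ∃ (S₀ : Set (HeightOneSpectrum (𝓞 K))) (α₀ β₀ : SatakeFamily K),
        (∀ v ∈ S₀, ¬ IsUnramifiedAt P.1 v ∨ ¬ IsUnramifiedAt P'.1 v) ∧
          IsSatakeFamilyOf P S₀ α₀ ∧ IsSatakeFamilyOf P' S₀ β₀ ∧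
            ∃ g₀ : ℂ → ℂ, Differentiable ℂ g₀ ∧
              ∀ s : ℂ, 1 < s.re → g₀ s = partialPairL S₀ α₀ β₀ s) :
    MoeglinWaldspurger1989_partialPairL_entire_of_ne_conj (n := n) (K := K) (μ := μ) := by
  intro hn h₁ P P' hne S hS α β hα hβ
  obtain ⟨S₀, α₀, β₀, hram, hα₀, hβ₀, h₀⟩ := h hn h₁ P P' hne
  exact exists_entire_eq_partialPairL_of_ramified_datum P P' hram hα₀ hβ₀ h₀ hS hα hβ

/-- **Tightness: the named fact is equivalent to its one-family form** (the converse takes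
`S₀` = the joint ramified set, finite by Flath (`finite_setOf_not_isUnramifiedAt_or`), with the
Satake families of `exists_isSatakeFamilyOf_pair_ramified`). [cite: MoeglinWaldspurger1989, Appendice, Corollaire (i)(b), p. 667] -/
theorem MoeglinWaldspurger1989_partialPairL_entire_of_ne_conj_iff_one_family :
    MoeglinWaldspurger1989_partialPairL_entire_of_ne_conj (n := n) (K := K) (μ := μ) ↔
    ∀ (_hn : 0 < n) (_h₁ : multiplicity_one_gl n K μ) (P P' : CuspidalAutomorphicRepGL n K μ)
      (_hne : P ≠ P'.conj),
      ∃ (S₀ : Set (HeightOneSpectrum (𝓞 K))) (α₀ β₀ : SatakeFamily K),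
        (∀ v ∈ S₀, ¬ IsUnramifiedAt P.1 v ∨ ¬ IsUnramifiedAt P'.1 v) ∧
          IsSatakeFamilyOf P S₀ α₀ ∧ IsSatakeFamilyOf P' S₀ β₀ ∧
            ∃ g₀ : ℂ → ℂ, Differentiable ℂ g₀ ∧
              ∀ s : ℂ, 1 < s.re → g₀ s = partialPairL S₀ α₀ β₀ s := by
  refine ⟨fun h hn h₁ P P' hne => ?_,
    MoeglinWaldspurger1989_partialPairL_entire_of_ne_conj_of_one_family⟩
  obtain ⟨α₀, β₀, hα₀, hβ₀⟩ := exists_isSatakeFamilyOf_pair_ramified P P'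
  exact ⟨_, α₀, β₀, fun v hv => hv, hα₀, hβ₀,
    h hn h₁ P P' hne (finite_setOf_not_isUnramifiedAt_or P P') hα₀ hβ₀⟩

/-- **Symmetry `π ↔ σ`.** Condition (b) is symmetric (`π ≠ σ̄ ↔ σ ≠ π̄`,
`CuspidalAutomorphicRepGL.conj_eq_iff_eq_conj`) and `L^S(s, α ⊗ β) = L^S(s, β ⊗ α)`
(`partialPairL_comm`): the conclusion of the fact for the pair `(σ, π)` gives it for `(π, σ)`. In
particular any analytic input may be supplied with the roles of `π` and `σ` exchanged. [folklore] -/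
theorem MoeglinWaldspurger1989_partialPairL_entire_of_ne_conj_of_swap
    (h : ∀ (_hn : 0 < n) (_h₁ : multiplicity_one_gl n K μ) (P P' : CuspidalAutomorphicRepGL n K μ)
      (_hne : P ≠ P'.conj) {S : Set (HeightOneSpectrum (𝓞 K))} (_hS : S.Finite)
      {α β : SatakeFamily K} (_hα : IsSatakeFamilyOf P S α) (_hβ : IsSatakeFamilyOf P' S β),
      ∃ g : ℂ → ℂ, Differentiable ℂ g ∧ ∀ s : ℂ, 1 < s.re → g s = partialPairL S β α s) :
    MoeglinWaldspurger1989_partialPairL_entire_of_ne_conj (n := n) (K := K) (μ := μ) := by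
  intro hn h₁ P P' hne S hS α β hα hβ
  have hne' : P' ≠ P.conj := fun h' =>
    hne (CuspidalAutomorphicRepGL.conj_eq_iff_eq_conj.1 h'.symm)
  obtain ⟨g, hg, hgL⟩ := h hn h₁ P' P hne' hS hβ hα
  exact ⟨g, hg, fun s hs => by rw [hgL s hs, partialPairL_comm S α β]⟩

end OneFamily

/-! ### The fact from entire quotient representations / vanishing residues at the ramified set -/

section Quotients

variable {n : ℕ} {K : Type} [Field K] [NumberField K]
  {μ : Measure (gl n K).automorphicQuotient} [(gl n K).IsAutomorphicMeasure μ]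

/-- **Mœglin–Waldspurger, Corollaire (i)(b), from entire quotient representations at the ramified
set** — the whole printed Rankin–Selberg road but its analytic input: if every pair `π ≠ σ̄`
(`n ≥ 1`, multiplicity one) carries Satake families `α₀`, `β₀` off a set `S₀` of places each
ramified for `π` or `σ`, an abscissa `x₀`, and for every `s₀ ∈ ℂ` entire `J`, `A` with `A(s₀) ≠ 0`,
`J = A · L^{S₀}(α₀ ⊗ β₀)` on `Re s > x₀` (Cogdell (2004), proof of Thm. 4.2 for `m = n`: the global
integrals `I(s; φ, φ', Φ)` are entire for `π ≇ π̃'`, `π ≇ π̃' ⊗ |det|`; Thm. 3.3 / §4.1: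
`I = ∏_v Ψ_v` with `Ψ_v = L(s, π_v × σ_v)` off `S₀ ∪ S_∞` and `Ψ_v = e_v L(s, π_v × σ_v)`, `e_v`
entire, `e_v(s₀) ≠ 0` for suitable data, at `v ∈ S₀ ∪ S_∞`), then the named fact holds
(`exists_entire_eq_partialPairL_of_entire_quotients_of_isSatakeFamilyOf` and the one-family form).
[cite: CogdellAnalyticTheory2004, Thm. 4.2, §4.2] [cite: MoeglinWaldspurger1989, Appendice, Corollaire (i)(b), p. 667] -/
theorem MoeglinWaldspurger1989_partialPairL_entire_of_ne_conj_of_entire_quotients_ramified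
    (h : ∀ (_hn : 0 < n) (_h₁ : multiplicity_one_gl n K μ) (P P' : CuspidalAutomorphicRepGL n K μ)
      (_hne : P ≠ P'.conj),
      ∃ (S₀ : Set (HeightOneSpectrum (𝓞 K))) (α₀ β₀ : SatakeFamily K),
        (∀ v ∈ S₀, ¬ IsUnramifiedAt P.1 v ∨ ¬ IsUnramifiedAt P'.1 v) ∧
          IsSatakeFamilyOf P S₀ α₀ ∧ IsSatakeFamilyOf P' S₀ β₀ ∧
            ∃ x₀ : ℝ, ∀ s₀ : ℂ, ∃ J A : ℂ → ℂ, Differentiable ℂ J ∧ Differentiable ℂ A ∧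
              A s₀ ≠ 0 ∧ ∀ s : ℂ, x₀ < s.re → J s = A s * partialPairL S₀ α₀ β₀ s) :
    MoeglinWaldspurger1989_partialPairL_entire_of_ne_conj (n := n) (K := K) (μ := μ) := by
  refine MoeglinWaldspurger1989_partialPairL_entire_of_ne_conj_of_one_family
    fun hn h₁ P P' hne => ?_
  obtain ⟨S₀, α₀, β₀, hram, hα₀, hβ₀, x₀, hq⟩ := h hn h₁ P P' hne
  exact ⟨S₀, α₀, β₀, hram, hα₀, hβ₀,
    exists_entire_eq_partialPairL_of_entire_quotients_of_isSatakeFamilyOf P P' hα₀ hβ₀ hq⟩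

/-- **Mœglin–Waldspurger, Corollaire (i)(b), from the Corollaire-(ii)-shaped datum at the
ramified set**: if every pair `π ≠ σ̄` (`n ≥ 1`, multiplicity one) carries Satake families `α₀`,
`β₀` off a set `S₀` of places each ramified for `π` or `σ` and an entire `G` with `G 0 = 0`,
`G 1 = 0` and `G s = s (s - 1) L^{S₀}(s, α₀ ⊗ β₀)` for `Re s > 1` — the output of the whole-plane
theory of `s (s - 1) I(s; φ, φ', Φ)` once the residues at `s = 0, 1` (`∝ ∫ φ φ' = 0` for `π ≠ σ̄`,
`integral_mul_eq_zero_of_ne_conj`) are known to vanish — then the named fact holds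
(`exists_entire_eq_of_entire_mul_of_apply_eq_zero` and the one-family form).
[cite: MoeglinWaldspurger1989, Appendice, Corollaire (i)(b), p. 667] -/
theorem MoeglinWaldspurger1989_partialPairL_entire_of_ne_conj_of_entire_mul_ramified
    (h : ∀ (_hn : 0 < n) (_h₁ : multiplicity_one_gl n K μ) (P P' : CuspidalAutomorphicRepGL n K μ)
      (_hne : P ≠ P'.conj),
      ∃ (S₀ : Set (HeightOneSpectrum (𝓞 K))) (α₀ β₀ : SatakeFamily K),
        (∀ v ∈ S₀, ¬ IsUnramifiedAt P.1 v ∨ ¬ IsUnramifiedAt P'.1 v) ∧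
          IsSatakeFamilyOf P S₀ α₀ ∧ IsSatakeFamilyOf P' S₀ β₀ ∧
            ∃ G : ℂ → ℂ, Differentiable ℂ G ∧ G 0 = 0 ∧ G 1 = 0 ∧
              ∀ s : ℂ, 1 < s.re → G s = s * (s - 1) * partialPairL S₀ α₀ β₀ s) :
    MoeglinWaldspurger1989_partialPairL_entire_of_ne_conj (n := n) (K := K) (μ := μ) := by
  refine MoeglinWaldspurger1989_partialPairL_entire_of_ne_conj_of_one_family
    fun hn h₁ P P' hne => ?_
  obtain ⟨S₀, α₀, β₀, hram, hα₀, hβ₀, G, hG, h0, h1, hGL⟩ := h hn h₁ P P' hne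
  exact ⟨S₀, α₀, β₀, hram, hα₀, hβ₀, exists_entire_eq_of_entire_mul_of_apply_eq_zero hG h0 h1 hGL⟩

end Quotients

end Literature.NumberTheory.Automorphic
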